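import Literature.Probability.RandomPlanarGeometry.SLESameSideMartingale
import Literature.Probability.RandomPlanarGeometry.SLESameSideKernel
import Literature.Analysis.Calculus.SmoothIntervalExtension
import HarnessLib

/-!
# Two boundary points on the same side are swallowed simultaneously with positive probability (`4 < κ < 8`)

Trunk T-STOCH. The weak form of S. Rohde, O. Schramm, *Basic properties of SLE*, Ann. of Math. 161
(2005), Lemma 6.6 (p. 908) needed for Lemma 7.3 ("for `a < b < 0` there is a positive probability
that the interval `[a, b]` is swallowed all at once"): **for `4 < κ < 8` and `0 < y < x`,
`P[T_y = T_x] > 0`**, where `T_z` is the swallowing time of the real point `z` under the SLE_κ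
flow (so that `[y, x]` is swallowed at once exactly when `T_y = T_x`).

Proof (a positivity-only version of the hitting-probability computation behind (6.13), through
Lawler's ratio `Z = X/(X - Y) ∈ (1, ∞)`): with `h = sameSideH (2/κ)` (a bounded increasing
solution of (6.21) on `(1, ∞)`, bounded since `κ < 8`, `SLESameSideKernel`) and the stopped
martingale `h(Z_{t∧ρ})` of `SLESameSideMartingale` (`ρ` = exit of `Y` from `(δ₁, R₁)` or of `Z`
from `(1+δ₀, 1+R)`), the constancy of expectations gives, uniformly in `R, δ₁, R₁, t`,
`P[h(Z_{t∧ρ}) > h(1+δ₀)] ≥ c₁ > 0` (`measureReal_obs_gt_ge`). On that event, unless `T_y > t`,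
the stopping has occurred, and then either `Z` has reached `1 + R` before `T_y`, or `Y` has reached
`R₁`, or `Y = δ₁` while `X ≤ (1+δ₀)δ₁/δ₀` (`obs_gt_subset`). Letting `t → ∞` (`T_y < ∞` a.s.,
`κ > 4`), `R₁ → ∞` (paths are bounded up to `T_y`), `δ₁ → 0` (if both flows are small together
infinitely often then `T_x = T_y`), and finally `R → ∞` (if the ratio is unbounded before `T_y`
then `T_x = T_y`), one gets `P[T_y = T_x] ≥ c₁/2`.

Main results: `measure_swallowingTime_eq_pos` (the displayed statement).

## References

* S. Rohde, O. Schramm, *Basic properties of SLE*, Ann. of Math. 161 (2005), Lemma 6.6 and its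
  proof (p. 908: "the local martingale … optional sampling"), Lemma 7.3.
* G. F. Lawler, *Conformally Invariant Processes in the Plane*, AMS (2005), Prop. 6.33.
-/

noncomputable section

open MeasureTheory ProbabilityTheory Filter Set Topology
open scoped NNReal ENNReal

namespace Literature.Probability.RandomPlanarGeometry

open Loewner Literature.Probability.Process Literature.Analysis.FunctionSpaces
  Literature.Analysis.Calculus

variable {κ : ℝ≥0} {x y : ℝ}

/-! ### The events of the limiting argument -/

variable (κ x y) in
/-- "**The ratio `X/(X - Y)` exceeds `R` at some rational time before `T_y`.**" [folklore] -/
def sleRatioExceeds (R : ℝ) : Set (ℝ≥0 → ℝ) :=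
  {ω | ∃ q : ℚ, 0 < sleRealFlowStop κ y (q : ℝ).toNNReal ω ∧
    R < sleRealFlowStop κ x (q : ℝ).toNNReal ω /
      (sleRealFlowStop κ x (q : ℝ).toNNReal ω - sleRealFlowStop κ y (q : ℝ).toNNReal ω)}

variable (κ y) in
/-- "**`Y` exceeds `R₁ - 1` at some rational time before `T_y`.**" [folklore] -/
def sleFlowExceeds (R₁ : ℝ) : Set (ℝ≥0 → ℝ) :=
  {ω | ∃ q : ℚ, 0 < sleRealFlowStop κ y (q : ℝ).toNNReal ω ∧ R₁ - 1 < sleRealFlowStop κ y (q : ℝ).toNNReal ω}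

variable (κ x y) in
/-- "**Both flows are small together at some rational time before `T_y`**": `Y < 2δ₁` and
`X < 2Cδ₁`. [folklore] -/
def sleFlowsSmall (C δ₁ : ℝ) : Set (ℝ≥0 → ℝ) :=
  {ω | ∃ q : ℚ, 0 < sleRealFlowStop κ y (q : ℝ).toNNReal ω ∧ sleRealFlowStop κ y (q : ℝ).toNNReal ω < 2 * δ₁ ∧
    sleRealFlowStop κ x (q : ℝ).toNNReal ω < 2 * C * δ₁}

section Measurable

variable (hy : 0 < y) (hyx : y < x)
include hy hyx

omit hyx in
/-- Measurability of `sleFlowExceeds`. [folklore] -/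
theorem measurableSet_sleFlowExceeds (R₁ : ℝ) : MeasurableSet (sleFlowExceeds κ y R₁) := by
  have hmy : ∀ q : ℚ, Measurable fun ω ↦ sleRealFlowStop κ y (q : ℝ).toNNReal ω := fun q ↦
    (adapted_sleRealFlowStop κ hy.ne' _).mono (brownianFiltration.le _) le_rfl
  have hset : sleFlowExceeds κ y R₁ = ⋃ q : ℚ, ({ω | 0 < sleRealFlowStop κ y (q : ℝ).toNNReal ω} ∩
      {ω | R₁ - 1 < sleRealFlowStop κ y (q : ℝ).toNNReal ω}) := by
    ext ω; simp only [sleFlowExceeds, mem_setOf_eq, mem_iUnion, mem_inter_iff]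
  rw [hset]
  exact MeasurableSet.iUnion fun q ↦ (measurableSet_lt measurable_const (hmy q)).inter
    (measurableSet_lt measurable_const (hmy q))

/-- Measurability of `sleRatioExceeds`. [folklore] -/
theorem measurableSet_sleRatioExceeds (R : ℝ) : MeasurableSet (sleRatioExceeds κ x y R) := by
  have hx : 0 < x := hy.trans hyx
  have hmy : ∀ q : ℚ, Measurable fun ω ↦ sleRealFlowStop κ y (q : ℝ).toNNReal ω := fun q ↦
    (adapted_sleRealFlowStop κ hy.ne' _).mono (brownianFiltration.le _) le_rfl
  have hmx : ∀ q : ℚ, Measurable fun ω ↦ sleRealFlowStop κ x (q : ℝ).toNNReal ω := fun q ↦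
    (adapted_sleRealFlowStop κ hx.ne' _).mono (brownianFiltration.le _) le_rfl
  have hset : sleRatioExceeds κ x y R = ⋃ q : ℚ, ({ω | 0 < sleRealFlowStop κ y (q : ℝ).toNNReal ω} ∩
      {ω | R < sleRealFlowStop κ x (q : ℝ).toNNReal ω /
        (sleRealFlowStop κ x (q : ℝ).toNNReal ω - sleRealFlowStop κ y (q : ℝ).toNNReal ω)}) := by
    ext ω; simp only [sleRatioExceeds, mem_setOf_eq, mem_iUnion, mem_inter_iff]
  rw [hset]
  exact MeasurableSet.iUnion fun q ↦ (measurableSet_lt measurable_const (hmy q)).inter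
    (measurableSet_lt measurable_const ((hmx q).div ((hmx q).sub (hmy q))))

/-- Measurability of `sleFlowsSmall`. [folklore] -/
theorem measurableSet_sleFlowsSmall (C δ₁ : ℝ) : MeasurableSet (sleFlowsSmall κ x y C δ₁) := by
  have hx : 0 < x := hy.trans hyx
  have hmy : ∀ q : ℚ, Measurable fun ω ↦ sleRealFlowStop κ y (q : ℝ).toNNReal ω := fun q ↦
    (adapted_sleRealFlowStop κ hy.ne' _).mono (brownianFiltration.le _) le_rfl
  have hmx : ∀ q : ℚ, Measurable fun ω ↦ sleRealFlowStop κ x (q : ℝ).toNNReal ω := fun q ↦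
    (adapted_sleRealFlowStop κ hx.ne' _).mono (brownianFiltration.le _) le_rfl
  have hset : sleFlowsSmall κ x y C δ₁ = ⋃ q : ℚ, (({ω | 0 < sleRealFlowStop κ y (q : ℝ).toNNReal ω} ∩
      {ω | sleRealFlowStop κ y (q : ℝ).toNNReal ω < 2 * δ₁}) ∩
      {ω | sleRealFlowStop κ x (q : ℝ).toNNReal ω < 2 * C * δ₁}) := by
    ext ω; simp only [sleFlowsSmall, mem_setOf_eq, mem_iUnion, mem_inter_iff, and_assoc]
  rw [hset]
  exact MeasurableSet.iUnion fun q ↦ ((measurableSet_lt measurable_const (hmy q)).inter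
    (measurableSet_lt (hmy q) measurable_const)).inter (measurableSet_lt (hmx q) measurable_const)

end Measurable

/-! ### Pathwise: rational times near a given time, and the limiting inclusions -/

/-- If a continuous function of `ℝ≥0` satisfies a strict inequality at a positive time `r`, it does
so at some rational time `q ∈ (0, r]`. [folklore] -/
theorem exists_rat_le_of_continuousAt {φ : ℝ≥0 → ℝ} {r : ℝ≥0} (hr : 0 < r) {c : ℝ}
    (hφ : ContinuousAt φ r) (hc : c < φ r) :
    ∃ q : ℚ, 0 < (q : ℝ) ∧ (q : ℝ).toNNReal ≤ r ∧ c < φ (q : ℝ).toNNReal := by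
  have ho : ∀ᶠ s in 𝓝 r, c < φ s := hφ.eventually (lt_mem_nhds hc)
  obtain ⟨ε, hε, hball⟩ := Metric.eventually_nhds_iff_ball.1 ho
  have hr' : (0 : ℝ) < r := hr
  obtain ⟨q, hq1, hq2⟩ := exists_rat_btwn (show max ((r : ℝ) - ε / 2) ((r : ℝ) / 2) < r by
    refine max_lt (by linarith) (by linarith))
  have hq0 : (0 : ℝ) < q := lt_of_le_of_lt (by positivity) (lt_of_le_of_lt (le_max_right _ _) hq1)
  refine ⟨q, hq0, ?_, hball _ ?_⟩
  · exact Real.toNNReal_le_iff_le_coe.2 hq2.le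
  · rw [Metric.mem_ball, NNReal.dist_eq, Real.coe_toNNReal _ hq0.le, abs_sub_lt_iff]
    constructor <;> linarith [le_max_left ((r : ℝ) - ε / 2) ((r : ℝ) / 2)]

section Pathwise

variable (hy : 0 < y) (hyx : y < x)
include hy hyx

omit hyx in
/-- **A path whose flow `Y` is unbounded before `T_y` has `T_y = ∞`** (a continuous path is bounded
on `[0, T_y]`): `⋂ₙ sleFlowExceeds n ⊆ {T_y = ∞}`. [folklore] -/
theorem swallowingTime_eq_top_of_forall_sleFlowExceeds {ω : ℝ≥0 → ℝ}
    (h : ∀ n : ℕ, ω ∈ sleFlowExceeds κ y n) : swallowingTime (sleDriving κ ω) y = ⊤ := by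
  by_contra hT
  obtain ⟨T, hT'⟩ := WithTop.ne_top_iff_exists.1 hT
  -- `Y` is bounded on `[0, T]`
  obtain ⟨M, hM⟩ := (isCompact_Icc (a := (0 : ℝ≥0)) (b := T)).exists_bound_of_continuousOn
    (f := fun s ↦ sleRealFlowStop κ y s ω) ((continuous_sleRealFlowStop hy.ne' ω).continuousOn)
  obtain ⟨n, hn⟩ := exists_nat_gt (M + 1)
  obtain ⟨q, hq0, hq⟩ := h n
  -- the rational time is before `T_y = T`
  have hqT : (q : ℝ).toNNReal ≤ T := by
    have hlt : (((q : ℝ).toNNReal : ℝ≥0) : WithTop ℝ≥0) < swallowingTime (sleDriving κ ω) y :=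
      coe_lt_swallowingTime_of_realFlowStop_ne_zero (W := sleDriving κ ω)
        (by rw [← sleRealFlowStop_apply]; exact hq0.ne')
    rw [← hT', WithTop.coe_lt_coe] at hlt
    exact hlt.le
  have h1 := hM _ ⟨bot_le, hqT⟩
  rw [Real.norm_eq_abs] at h1
  linarith [le_abs_self (sleRealFlowStop κ y (q : ℝ).toNNReal ω)]

/-- **If both flows are small together infinitely often (at scales `δ₁ → 0`) then `T_x = T_y`**
(provided `T_y < ∞`): a limit point `s` of the rational times has `X_s = Y_s = 0`, so
`T_x ≤ s ≤ T_y ≤ T_x`. [folklore] -/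
theorem swallowingTime_eq_of_frequently_sleFlowsSmall {C : ℝ} {ω : ℝ≥0 → ℝ}
    {d : ℕ → ℝ} (hd : Tendsto d atTop (𝓝 0)) (h : ∃ᶠ n in atTop, ω ∈ sleFlowsSmall κ x y C (d n))
    (hT : swallowingTime (sleDriving κ ω) y ≠ ⊤) :
    swallowingTime (sleDriving κ ω) y = swallowingTime (sleDriving κ ω) x := by
  have hx : 0 < x := hy.trans hyx
  have hW : Continuous (sleDriving κ ω) := continuous_sleDriving κ ω
  have hy0 : sleDriving κ ω 0 < y := by rw [sleDriving_zero]; exact hy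
  have hx0 : sleDriving κ ω 0 < x := by rw [sleDriving_zero]; exact hx
  obtain ⟨T, hT'⟩ := WithTop.ne_top_iff_exists.1 hT
  have hle : swallowingTime (sleDriving κ ω) y ≤ swallowingTime (sleDriving κ ω) x :=
    swallowingTime_mono_right hW hy0 hyx.le
  refine le_antisymm hle ?_
  -- extract a subsequence of rational times in `[0, T]` with both flows small
  obtain ⟨φ, hφ, hmem⟩ := extraction_of_frequently_atTop h
  choose q hq0 hqY hqX using hmem
  have hqT : ∀ n, (q n : ℝ).toNNReal ∈ Icc (0 : ℝ≥0) T := by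
    intro n
    refine ⟨bot_le, ?_⟩
    have hlt : (((q n : ℝ).toNNReal : ℝ≥0) : WithTop ℝ≥0) < swallowingTime (sleDriving κ ω) y :=
      coe_lt_swallowingTime_of_realFlowStop_ne_zero (W := sleDriving κ ω)
        (by rw [← sleRealFlowStop_apply]; exact (hq0 n).ne')
    rw [← hT', WithTop.coe_lt_coe] at hlt
    exact hlt.le
  obtain ⟨s, -, ψ, hψ, hconv⟩ := (isCompact_Icc (a := (0 : ℝ≥0)) (b := T)).tendsto_subseq hqT
  -- at the limit time both flows vanish
  have hdφψ : Tendsto (fun n ↦ d (φ (ψ n))) atTop (𝓝 0) :=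
    hd.comp (hφ.tendsto_atTop.comp hψ.tendsto_atTop)
  have hXlim : Tendsto (fun n ↦ sleRealFlowStop κ x (q (ψ n) : ℝ).toNNReal ω) atTop
      (𝓝 (sleRealFlowStop κ x s ω)) := ((continuous_sleRealFlowStop hx.ne' ω).tendsto s).comp hconv
  have hX0 : sleRealFlowStop κ x s ω ≤ 0 := by
    refine le_of_tendsto_of_tendsto hXlim (show Tendsto (fun n ↦ 2 * C * d (φ (ψ n))) atTop (𝓝 0) from by
      simpa using hdφψ.const_mul (2 * C)) (Eventually.of_forall fun n ↦ (hqX (ψ n)).le)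
  have hXs : sleRealFlowStop κ x s ω = 0 :=
    le_antisymm hX0 (by rw [sleRealFlowStop_apply]; exact realFlowStop_nonneg hW hx0 s)
  -- hence `T_x ≤ s ≤ T = T_y`
  have hTx : swallowingTime (sleDriving κ ω) x ≤ s := by
    by_contra hlt
    rw [not_le] at hlt
    have := (realFlowStop_pos_iff hW hx0).2 hlt
    rw [← sleRealFlowStop_apply, hXs] at this
    exact lt_irrefl _ this
  have hsT : s ∈ Icc (0 : ℝ≥0) T := isClosed_Icc.mem_of_tendsto hconv (Eventually.of_forall fun n ↦ hqT _)
  rw [← hT']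
  exact hTx.trans (WithTop.coe_le_coe.2 hsT.2)

/-- **If the ratio `X/(X - Y)` is unbounded before `T_y` then `T_x = T_y`** (provided `T_y < ∞`):
otherwise `T_y < T_x`, the gap `X - Y` is bounded below on `[0, T_y]` (it is positive and
continuous there, `X_{T_y} > 0 = Y_{T_y}`), and the ratio is bounded. [folklore] -/
theorem swallowingTime_eq_of_forall_sleRatioExceeds {ω : ℝ≥0 → ℝ}
    (h : ∀ n : ℕ, ω ∈ sleRatioExceeds κ x y n) (hT : swallowingTime (sleDriving κ ω) y ≠ ⊤) :
    swallowingTime (sleDriving κ ω) y = swallowingTime (sleDriving κ ω) x := by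
  have hx : 0 < x := hy.trans hyx
  have hW : Continuous (sleDriving κ ω) := continuous_sleDriving κ ω
  have hy0 : sleDriving κ ω 0 < y := by rw [sleDriving_zero]; exact hy
  have hx0 : sleDriving κ ω 0 < x := by rw [sleDriving_zero]; exact hx
  obtain ⟨T, hT'⟩ := WithTop.ne_top_iff_exists.1 hT
  have hle : swallowingTime (sleDriving κ ω) y ≤ swallowingTime (sleDriving κ ω) x :=
    swallowingTime_mono_right hW hy0 hyx.le
  rcases hle.eq_or_lt with h' | hlt
  · exact h'
  exfalso
  -- `T_y = T < T_x`: the gap is positive on `[0, T]`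
  have hTlt : ((T : ℝ≥0) : WithTop ℝ≥0) < swallowingTime (sleDriving κ ω) x := by rw [hT']; exact hlt
  have hgap : ∀ s ∈ Icc (0 : ℝ≥0) T, 0 < sleRealFlowStop κ x s ω - sleRealFlowStop κ y s ω := by
    intro s hs
    rcases hs.2.eq_or_lt with h' | hsT
    · -- at `T`: `Y_T = 0 < X_T`
      rw [h', sleRealFlowStop_apply κ y, realFlowStop_of_le (by rw [← hT']), sub_zero]
      rw [sleRealFlowStop_apply]
      exact (realFlowStop_pos_iff hW hx0).2 hTlt
    · have hsy : ((s : ℝ≥0) : WithTop ℝ≥0) < swallowingTime (sleDriving κ ω) y := by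
        rw [← hT']; exact WithTop.coe_lt_coe.2 hsT
      exact sub_pos.2 (sleRealFlowStop_sameSide_facts hy hyx hsy).2.1
  -- hence bounded below by a positive constant, and `X` bounded above
  have hK : IsCompact (Icc (0 : ℝ≥0) T) := isCompact_Icc
  have hne : (Icc (0 : ℝ≥0) T).Nonempty := ⟨0, left_mem_Icc.2 bot_le⟩
  have hDc : ContinuousOn (fun s ↦ sleRealFlowStop κ x s ω - sleRealFlowStop κ y s ω) (Icc 0 T) :=
    ((continuous_sleRealFlowStop hx.ne' ω).sub (continuous_sleRealFlowStop hy.ne' ω)).continuousOn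
  obtain ⟨s₀, hs₀, hmin⟩ := hK.exists_isMinOn hne hDc
  obtain ⟨M, hM⟩ := hK.exists_bound_of_continuousOn (f := fun s ↦ sleRealFlowStop κ x s ω)
    ((continuous_sleRealFlowStop hx.ne' ω).continuousOn)
  set m := sleRealFlowStop κ x s₀ ω - sleRealFlowStop κ y s₀ ω with hm
  have hm0 : 0 < m := hgap s₀ hs₀
  have hM0 : 0 ≤ M := le_trans (norm_nonneg _) (hM 0 (left_mem_Icc.2 bot_le))
  -- the ratio is at most `M/m` on `[0, T]`, contradicting unboundedness
  obtain ⟨n, hn⟩ := exists_nat_gt (M / m)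
  obtain ⟨q, hq0, hq⟩ := h n
  have hqT : ((q : ℝ).toNNReal : ℝ≥0) ∈ Icc (0 : ℝ≥0) T := by
    refine ⟨bot_le, ?_⟩
    have hlt' : (((q : ℝ).toNNReal : ℝ≥0) : WithTop ℝ≥0) < swallowingTime (sleDriving κ ω) y :=
      coe_lt_swallowingTime_of_realFlowStop_ne_zero (W := sleDriving κ ω)
        (by rw [← sleRealFlowStop_apply]; exact hq0.ne')
    rw [← hT', WithTop.coe_lt_coe] at hlt'
    exact hlt'.le
  have hD := hmin hqT
  have hXq := hM _ hqT
  rw [Real.norm_eq_abs] at hXq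
  have hDq : m ≤ sleRealFlowStop κ x (q : ℝ).toNNReal ω - sleRealFlowStop κ y (q : ℝ).toNNReal ω := hD
  have hratio : sleRealFlowStop κ x (q : ℝ).toNNReal ω /
      (sleRealFlowStop κ x (q : ℝ).toNNReal ω - sleRealFlowStop κ y (q : ℝ).toNNReal ω) ≤ M / m := by
    rw [div_le_div_iff₀ (hm0.trans_le hDq) hm0]
    have h1 : sleRealFlowStop κ x (q : ℝ).toNNReal ω ≤ M := (le_abs_self _).trans hXq
    nlinarith
  linarith

end Pathwise

/-! ### The case analysis at a fixed time -/

section Levels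

variable (hy : 0 < y) (hyx : y < x) {δ₀ R δ₁ R₁ : ℝ} (hδ₀ : 0 < δ₀) (hz₀ : 1 + δ₀ < x / (x - y))
  (hz₀' : x / (x - y) < 1 + R) (hδ₁ : 0 < δ₁) (hδ₁y : δ₁ < y) (hyR₁ : y < R₁)
include hy hyx hδ₀ hz₀ hz₀' hδ₁ hδ₁y hyR₁

/-- **The case analysis.** If at time `t` the ratio of the flows stopped at the same-side stopping
time exceeds `1 + δ₀`, then either `T_y > t`, or the (unstopped) ratio has exceeded `R` before
`T_y`, or `Y` has exceeded `R₁ - 1` before `T_y`, or both flows have been small together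
(`Y < 2δ₁`, `X < 2(1+δ₀)δ₁/δ₀`) before `T_y`. (If `T_y ≤ t` the stopping has occurred — `Y`
leaves `(δ₁, R₁)` strictly before `T_y` —, at an exit through `Z = 1 + R`, `Y = R₁` or `Y = δ₁`;
rational times nearby realise the events.) [cite: RohdeSchramm2005, proof of Lemma 6.6] -/
theorem sameSide_ratio_gt_subset (t : ℝ≥0) :
    {ω | 1 + δ₀ < stoppedProcess (sleRealFlowStop κ x) (sleSameSideTime κ x y δ₀ R δ₁ R₁) t ω /
        (stoppedProcess (sleRealFlowStop κ x) (sleSameSideTime κ x y δ₀ R δ₁ R₁) t ω -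
          stoppedProcess (sleRealFlowStop κ y) (sleSameSideTime κ x y δ₀ R δ₁ R₁) t ω)} ⊆
      {ω | (t : WithTop ℝ≥0) < swallowingTime (sleDriving κ ω) y} ∪ sleRatioExceeds κ x y R ∪
        sleFlowExceeds κ y R₁ ∪ sleFlowsSmall κ x y ((1 + δ₀) / δ₀) δ₁ := by
  intro ω hω
  have hx : 0 < x := hy.trans hyx
  by_cases hTt : (t : WithTop ℝ≥0) < swallowingTime (sleDriving κ ω) y
  · exact Or.inl (Or.inl (Or.inl hTt))
  rw [not_lt] at hTt
  obtain ⟨T, hT⟩ := WithTop.ne_top_iff_exists.1 (ne_top_of_le_ne_top WithTop.coe_ne_top hTt)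
  have hTt' : T ≤ t := by rw [← hT] at hTt; exact WithTop.coe_le_coe.1 hTt
  have hYc : Continuous fun s ↦ sleRealFlowStop κ y s ω := continuous_sleRealFlowStop hy.ne' ω
  have hXc : Continuous fun s ↦ sleRealFlowStop κ x s ω := continuous_sleRealFlowStop hx.ne' ω
  have hZhc : Continuous fun s ↦ sleSameSideRatio κ x y δ₁ R₁ s ω :=
    continuous_sleSameSideRatio hy hyx hδ₁ hδ₁y hyR₁ ω
  have hY0 : sleRealFlowStop κ y 0 ω ∈ Ioo δ₁ R₁ := by
    rw [sleRealFlowStop_zero_apply hy.ne']; exact ⟨hδ₁y, hyR₁⟩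
  have hZh0 : sleSameSideRatio κ x y δ₁ R₁ 0 ω ∈ Ioo (1 + δ₀) (1 + R) := by
    simp only [sleSameSideRatio, stoppedProcess, untopA_min_zero, sleRealFlowStop_zero_apply hx.ne',
      sleRealFlowStop_zero_apply hy.ne']
    exact ⟨hz₀, hz₀'⟩
  -- `Y_T = 0`, hence the exit time `τ` of `Y` from `(δ₁, R₁)` is `< T`
  have hYT : sleRealFlowStop κ y T ω = 0 := by
    rw [sleRealFlowStop_apply, realFlowStop_of_le (by rw [← hT])]
  have hτT : exitTime (sleRealFlowStop κ y) δ₁ R₁ ω < (T : WithTop ℝ≥0) := by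
    have hle : exitTime (sleRealFlowStop κ y) δ₁ R₁ ω ≤ (T : WithTop ℝ≥0) :=
      (exitTime_le_coe_iff hYc).2 ⟨T, le_rfl, fun h ↦ by rw [hYT] at h; linarith [h.1]⟩
    refine lt_of_le_of_ne hle fun heq ↦ ?_
    rcases apply_eq_or_eq_of_exitTime_eq_coe hYc hY0 heq with h | h
    · rw [hYT] at h; linarith
    · rw [hYT] at h; linarith
  obtain ⟨τ', hτ'⟩ := WithTop.ne_top_iff_exists.1 (ne_top_of_lt hτT)
  have hτ'T : τ' < T := by rw [← hτ'] at hτT; exact WithTop.coe_lt_coe.1 hτT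
  -- facts at times `≤ τ`
  have hfacts : ∀ {s : ℝ≥0}, (s : WithTop ℝ≥0) ≤ exitTime (sleRealFlowStop κ y) δ₁ R₁ ω →
      (s : WithTop ℝ≥0) < swallowingTime (sleDriving κ ω) y ∧ sleRealFlowStop κ y s ω ∈ Icc δ₁ R₁ ∧
        sleRealFlowStop κ y s ω < sleRealFlowStop κ x s ω :=
    fun hs ↦ sleRealFlowStop_facts_of_le_exitTime hy hyx hδ₁ hδ₁y hyR₁ hs
  have hZheq : ∀ {s : ℝ≥0}, (s : WithTop ℝ≥0) ≤ exitTime (sleRealFlowStop κ y) δ₁ R₁ ω →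
      sleSameSideRatio κ x y δ₁ R₁ s ω =
        sleRealFlowStop κ x s ω / (sleRealFlowStop κ x s ω - sleRealFlowStop κ y s ω) := by
    intro s hs
    unfold sleSameSideRatio
    rw [stoppedProcess_eq_of_le hs, stoppedProcess_eq_of_le hs]
  by_cases hcase : exitTime (sleSameSideRatio κ x y δ₁ R₁) (1 + δ₀) (1 + R) ω ≤
      exitTime (sleRealFlowStop κ y) δ₁ R₁ ω
  · -- Case 1: the ratio exits first (or simultaneously): `ρ = ρ_Z = r`
    have hρeq : sleSameSideTime κ x y δ₀ R δ₁ R₁ ω =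
        exitTime (sleSameSideRatio κ x y δ₁ R₁) (1 + δ₀) (1 + R) ω := min_eq_right hcase
    obtain ⟨r, hr⟩ := WithTop.ne_top_iff_exists.1
      (ne_top_of_le_ne_top (hτ' ▸ WithTop.coe_ne_top) hcase)
    have hrτ : ((r : ℝ≥0) : WithTop ℝ≥0) ≤ exitTime (sleRealFlowStop κ y) δ₁ R₁ ω := hr ▸ hcase
    have hrt : r ≤ t := by
      have : ((r : ℝ≥0) : WithTop ℝ≥0) ≤ T := hrτ.trans hτT.le
      exact (WithTop.coe_le_coe.1 this).trans hTt'
    have hρt : sleSameSideTime κ x y δ₀ R δ₁ R₁ ω ≤ (t : WithTop ℝ≥0) := by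
      rw [hρeq, ← hr]; exact WithTop.coe_le_coe.2 hrt
    have hstopX : stoppedProcess (sleRealFlowStop κ x) (sleSameSideTime κ x y δ₀ R δ₁ R₁) t ω =
        sleRealFlowStop κ x r ω := by
      rw [stoppedProcess_eq_of_ge hρt, hρeq, ← hr]; rfl
    have hstopY : stoppedProcess (sleRealFlowStop κ y) (sleSameSideTime κ x y δ₀ R δ₁ R₁) t ω =
        sleRealFlowStop κ y r ω := by
      rw [stoppedProcess_eq_of_ge hρt, hρeq, ← hr]; rfl
    have hω' : 1 + δ₀ < sleRealFlowStop κ x r ω / (sleRealFlowStop κ x r ω - sleRealFlowStop κ y r ω) := by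
      have h := hω
      simp only [mem_setOf_eq] at h
      rwa [hstopX, hstopY] at h
    -- exit value of the ratio
    have hexit := apply_eq_or_eq_of_exitTime_eq_coe hZhc hZh0 hr.symm
    rw [hZheq hrτ] at hexit
    rcases hexit with h1 | h1
    · linarith
    have hr0 : 0 < r := by
      have := exitTime_pos hZhc hZh0
      rw [← hr, WithTop.coe_pos] at this
      exact this
    obtain ⟨-, hYr, hYXr⟩ := hfacts hrτ
    have hcont : ContinuousAt (fun s ↦ sleRealFlowStop κ x s ω /
        (sleRealFlowStop κ x s ω - sleRealFlowStop κ y s ω)) r :=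
      (hXc.continuousAt).div ((hXc.sub hYc).continuousAt) (by linarith)
    obtain ⟨q, hq0, hqr, hq⟩ := exists_rat_le_of_continuousAt hr0 hcont
      (show R < sleRealFlowStop κ x r ω / (sleRealFlowStop κ x r ω - sleRealFlowStop κ y r ω) by linarith)
    have hqτ : (((q : ℝ).toNNReal : ℝ≥0) : WithTop ℝ≥0) ≤ exitTime (sleRealFlowStop κ y) δ₁ R₁ ω :=
      (WithTop.coe_le_coe.2 hqr).trans hrτ
    obtain ⟨-, hYq, -⟩ := hfacts hqτ
    exact Or.inl (Or.inl (Or.inr ⟨q, hδ₁.trans_le hYq.1, hq⟩))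
  · -- Case 2: `Y` exits first: `ρ = τ = τ'`
    rw [not_le] at hcase
    have hρeq : sleSameSideTime κ x y δ₀ R δ₁ R₁ ω = exitTime (sleRealFlowStop κ y) δ₁ R₁ ω :=
      min_eq_left hcase.le
    have hrτ : ((τ' : ℝ≥0) : WithTop ℝ≥0) ≤ exitTime (sleRealFlowStop κ y) δ₁ R₁ ω := hτ'.le
    have hrt : τ' ≤ t := hτ'T.le.trans hTt'
    have hρt : sleSameSideTime κ x y δ₀ R δ₁ R₁ ω ≤ (t : WithTop ℝ≥0) := by
      rw [hρeq, ← hτ']; exact WithTop.coe_le_coe.2 hrt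
    have hstopX : stoppedProcess (sleRealFlowStop κ x) (sleSameSideTime κ x y δ₀ R δ₁ R₁) t ω =
        sleRealFlowStop κ x τ' ω := by
      rw [stoppedProcess_eq_of_ge hρt, hρeq, ← hτ']; rfl
    have hstopY : stoppedProcess (sleRealFlowStop κ y) (sleSameSideTime κ x y δ₀ R δ₁ R₁) t ω =
        sleRealFlowStop κ y τ' ω := by
      rw [stoppedProcess_eq_of_ge hρt, hρeq, ← hτ']; rfl
    have hω' : 1 + δ₀ < sleRealFlowStop κ x τ' ω / (sleRealFlowStop κ x τ' ω - sleRealFlowStop κ y τ' ω) := by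
      have h := hω
      simp only [mem_setOf_eq] at h
      rwa [hstopX, hstopY] at h
    have hr0 : 0 < τ' := by
      have := exitTime_pos hYc hY0
      rw [← hτ', WithTop.coe_pos] at this
      exact this
    obtain ⟨-, hYr, hYXr⟩ := hfacts hrτ
    have hgap : 0 < sleRealFlowStop κ x τ' ω - sleRealFlowStop κ y τ' ω := sub_pos.2 hYXr
    -- exit value of `Y`
    rcases apply_eq_or_eq_of_exitTime_eq_coe hYc hY0 hτ'.symm with h1 | h1
    · -- `Y = δ₁` and `X < (1+δ₀)δ₁/δ₀`
      have hXr : sleRealFlowStop κ x τ' ω < (1 + δ₀) / δ₀ * δ₁ := by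
        have h2 : (1 + δ₀) * (sleRealFlowStop κ x τ' ω - sleRealFlowStop κ y τ' ω) <
            sleRealFlowStop κ x τ' ω := (lt_div_iff₀ hgap).1 hω'
        rw [h1] at h2
        rw [div_mul_eq_mul_div, lt_div_iff₀ hδ₀]
        nlinarith
      have hcont : ContinuousAt (fun s ↦ min (2 * δ₁ - sleRealFlowStop κ y s ω)
          (2 * ((1 + δ₀) / δ₀) * δ₁ - sleRealFlowStop κ x s ω)) τ' :=
        ((continuous_const.sub hYc).min (continuous_const.sub hXc)).continuousAt
      have hpos : 0 < min (2 * δ₁ - sleRealFlowStop κ y τ' ω)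
          (2 * ((1 + δ₀) / δ₀) * δ₁ - sleRealFlowStop κ x τ' ω) := by
        refine lt_min (by rw [h1]; linarith) ?_
        have : 0 < (1 + δ₀) / δ₀ * δ₁ := by positivity
        nlinarith
      obtain ⟨q, hq0, hqr, hq⟩ := exists_rat_le_of_continuousAt hr0 hcont hpos
      have hqτ : (((q : ℝ).toNNReal : ℝ≥0) : WithTop ℝ≥0) ≤ exitTime (sleRealFlowStop κ y) δ₁ R₁ ω :=
        (WithTop.coe_le_coe.2 hqr).trans hrτ
      obtain ⟨-, hYq, -⟩ := hfacts hqτ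
      refine Or.inr ⟨q, hδ₁.trans_le hYq.1, ?_, ?_⟩
      · linarith [min_le_left (2 * δ₁ - sleRealFlowStop κ y (q : ℝ).toNNReal ω)
          (2 * ((1 + δ₀) / δ₀) * δ₁ - sleRealFlowStop κ x (q : ℝ).toNNReal ω)]
      · linarith [min_le_right (2 * δ₁ - sleRealFlowStop κ y (q : ℝ).toNNReal ω)
          (2 * ((1 + δ₀) / δ₀) * δ₁ - sleRealFlowStop κ x (q : ℝ).toNNReal ω)]
    · -- `Y = R₁`
      have hcont : ContinuousAt (fun s ↦ sleRealFlowStop κ y s ω) τ' := hYc.continuousAt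
      obtain ⟨q, hq0, hqr, hq⟩ := exists_rat_le_of_continuousAt hr0 hcont
        (show R₁ - 1 < sleRealFlowStop κ y τ' ω by rw [h1]; linarith)
      have hqτ : (((q : ℝ).toNNReal : ℝ≥0) : WithTop ℝ≥0) ≤ exitTime (sleRealFlowStop κ y) δ₁ R₁ ω :=
        (WithTop.coe_le_coe.2 hqr).trans hrτ
      obtain ⟨-, hYq, -⟩ := hfacts hqτ
      exact Or.inl (Or.inr ⟨q, hδ₁.trans_le hYq.1, hq⟩)

/-- **The stopped-martingale bound**: for `4 < κ < 8`, with `h = sameSideH (2/κ)`, any bound `M`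
of `h` on `(1, ∞)` and the levels as above, for every `t`
`(h(z₀) - h(1+δ₀)) ≤ (M - h(1+δ₀)) · (P[T_y > t] + P[ratio exceeds R] + P[Y exceeds R₁ - 1] +
P[flows small])`, `z₀ = x/(x-y)`. (Constancy of the expectation of the stopped martingale
`h(Z_{t∧ρ})`, `martingale_apply_sameSideRatio_stopped`, and the case analysis.)
[cite: RohdeSchramm2005, proof of Lemma 6.6] -/
theorem sameSide_levels_bound (hκ4 : 4 < κ) {M : ℝ} (hM : ∀ z : ℝ, 1 < z → sameSideH (2 / (κ : ℝ)) z ≤ M)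
    (t : ℝ≥0) :
    sameSideH (2 / (κ : ℝ)) (x / (x - y)) - sameSideH (2 / (κ : ℝ)) (1 + δ₀) ≤
      (M - sameSideH (2 / (κ : ℝ)) (1 + δ₀)) *
        (preWienerMeasure.real {ω | (t : WithTop ℝ≥0) < swallowingTime (sleDriving κ ω) y} +
          preWienerMeasure.real (sleRatioExceeds κ x y R) + preWienerMeasure.real (sleFlowExceeds κ y R₁) +
          preWienerMeasure.real (sleFlowsSmall κ x y ((1 + δ₀) / δ₀) δ₁)) := by
  haveI := isProbabilityMeasure_preWienerMeasure'
  have hx : 0 < x := hy.trans hyx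
  have hκ0 : 0 < κ := lt_trans (by norm_num) hκ4
  set a : ℝ := 2 / (κ : ℝ) with ha
  set h := sameSideH a with hh
  have hz1 : 1 < 1 + δ₀ := by linarith
  -- a `C²` function equal to `h` near `[1+δ₀, 1+R]`
  obtain ⟨f, hf, hfeq, -⟩ := exists_contDiff_eqOn_Icc (n := 2) (a := 1) (b := R + 3) (lo := 1 + δ₀ / 2)
    (hi := R + 2) (by linarith) (by linarith [hz₀.trans hz₀']) (by linarith)
    ((contDiffOn_two_sameSideH a).mono fun z hz ↦ (show (1 : ℝ) < z from hz.1))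
  have hfnhds : ∀ z ∈ Icc (1 + δ₀) (1 + R), f =ᶠ[𝓝 z] h := by
    intro z hz
    have hmem : Ioo (1 + δ₀ / 2) (R + 2) ∈ 𝓝 z := Ioo_mem_nhds (by linarith [hz.1]) (by linarith [hz.2])
    filter_upwards [hmem] with u hu
    exact hfeq (Ioo_subset_Icc_self hu)
  have hzgt : ∀ z ∈ Icc (1 + δ₀) (1 + R), 1 < z := fun z hz ↦ lt_of_lt_of_le hz1 hz.1
  have hf1 : ∀ z ∈ Icc (1 + δ₀) (1 + R), deriv f z = sameSideKernel a z := by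
    intro z hz
    rw [(hfnhds z hz).deriv_eq]
    exact deriv_sameSideH a (hzgt z hz)
  have hf2 : ∀ z ∈ Icc (1 + δ₀) (1 + R),
      iteratedDeriv 2 f z = sameSideKernel a z * (-(2 * a) / z + 2 * a / (1 - z)) := by
    intro z hz
    rw [iteratedDeriv_succ, iteratedDeriv_one]
    have h1 : deriv f =ᶠ[𝓝 z] sameSideKernel a := by
      have hmem : Ioi (1 : ℝ) ∈ 𝓝 z := Ioi_mem_nhds (hzgt z hz)
      filter_upwards [(hfnhds z hz).deriv, hmem] with u hu hu'
      rw [hu]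
      exact deriv_sameSideH a hu'
    rw [h1.deriv_eq]
    exact (hasDerivAt_sameSideKernel a (hzgt z hz)).deriv
  have hmart := martingale_apply_sameSideRatio_stopped hκ0 hy hyx hδ₀ hz₀ hz₀' hδ₁ hδ₁y hyR₁ hf
    (K := sameSideKernel a) hf1 hf2
  set ρ := sleSameSideTime κ x y δ₀ R δ₁ R₁ with hρ
  set Zρ : ℝ≥0 → (ℝ≥0 → ℝ) → ℝ := fun t ω ↦ stoppedProcess (sleRealFlowStop κ x) ρ t ω /
    (stoppedProcess (sleRealFlowStop κ x) ρ t ω - stoppedProcess (sleRealFlowStop κ y) ρ t ω) with hZρ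
  -- the stopped ratio stays in `[1+δ₀, 1+R]`
  have hZmem : ∀ t ω, Zρ t ω ∈ Icc (1 + δ₀) (1 + R) := by
    intro t ω
    have h := (sleSameSide_bounds_of_le hy hyx hδ₀ hz₀ hz₀' hδ₁ hδ₁y hyR₁
      (coe_untopA_min_le t (ρ ω))).2.2.2.1
    simpa only [hZρ, stoppedProcess] using h
  have hO : ∀ t ω, f (Zρ t ω) = h (Zρ t ω) := fun t ω ↦ hfeq ⟨by linarith [(hZmem t ω).1], by linarith [(hZmem t ω).2]⟩
  -- expectation of the martingale
  have hE : ∫ ω, f (Zρ t ω) ∂preWienerMeasure = h (x / (x - y)) := by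
    have h1 := integral_eq_of_martingale hmart t
    rw [show (fun ω ↦ f (Zρ t ω)) = fun ω ↦ f (stoppedProcess (sleRealFlowStop κ x) ρ t ω /
      (stoppedProcess (sleRealFlowStop κ x) ρ t ω - stoppedProcess (sleRealFlowStop κ y) ρ t ω)) from rfl, h1]
    have h0 : ∀ ω, f (stoppedProcess (sleRealFlowStop κ x) ρ 0 ω /
        (stoppedProcess (sleRealFlowStop κ x) ρ 0 ω - stoppedProcess (sleRealFlowStop κ y) ρ 0 ω)) =
        h (x / (x - y)) := by
      intro ω
      have := hO 0 ω
      simp only [hZρ, stoppedProcess, untopA_min_zero, sleRealFlowStop_zero_apply hx.ne',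
        sleRealFlowStop_zero_apply hy.ne'] at this ⊢
      exact this
    simp only [h0, integral_const, smul_eq_mul, probReal_univ, one_mul]
  -- the event and the integral inequality
  set B : Set (ℝ≥0 → ℝ) := {ω | 1 + δ₀ < Zρ t ω} with hB
  have hBm : MeasurableSet B := by
    have hρst : IsStoppingTime brownianFiltration ρ :=
      isStoppingTime_sleSameSideTime (κ := κ) hy hyx hδ₁ hδ₁y hyR₁ δ₀ R
    have hmx : Measurable (stoppedProcess (sleRealFlowStop κ x) ρ t) :=
      (((isStronglyProgressive_sleRealFlowStop κ hx.ne').stronglyAdapted_stoppedProcess hρst) t).measurable.mono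
        (brownianFiltration.le t) le_rfl
    have hmy : Measurable (stoppedProcess (sleRealFlowStop κ y) ρ t) :=
      (((isStronglyProgressive_sleRealFlowStop κ hy.ne').stronglyAdapted_stoppedProcess hρst) t).measurable.mono
        (brownianFiltration.le t) le_rfl
    exact measurableSet_lt measurable_const (hmx.div (hmx.sub hmy))
  set Dn : ℝ := M - h (1 + δ₀) with hDn
  have hmono : StrictMonoOn h (Ioi 1) := strictMonoOn_sameSideH a
  have hpt : ∀ ω, f (Zρ t ω) - h (1 + δ₀) ≤ Dn * B.indicator (fun _ ↦ (1 : ℝ)) ω := by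
    intro ω
    rw [hO t ω]
    by_cases hω : ω ∈ B
    · rw [indicator_of_mem hω, mul_one]
      linarith [hM (Zρ t ω) (hzgt _ (hZmem t ω))]
    · rw [indicator_of_notMem hω, mul_zero, sub_nonpos]
      have hle : Zρ t ω ≤ 1 + δ₀ := not_lt.1 hω
      have heq : Zρ t ω = 1 + δ₀ := le_antisymm hle (hZmem t ω).1
      rw [heq]
  have hint : Integrable (fun ω ↦ f (Zρ t ω)) preWienerMeasure := hmart.integrable t
  have hI : h (x / (x - y)) - h (1 + δ₀) ≤ Dn * preWienerMeasure.real B := by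
    have h1 : ∫ ω, (f (Zρ t ω) - h (1 + δ₀)) ∂preWienerMeasure = h (x / (x - y)) - h (1 + δ₀) := by
      rw [integral_sub hint (integrable_const _), hE, integral_const, smul_eq_mul, probReal_univ, one_mul]
    have h2 : ∫ ω, Dn * B.indicator (fun _ ↦ (1 : ℝ)) ω ∂preWienerMeasure = Dn * preWienerMeasure.real B := by
      rw [integral_const_mul, integral_indicator_const _ hBm, smul_eq_mul, mul_one]
    rw [← h1, ← h2]
    exact integral_mono (hint.sub (integrable_const _))
      ((integrable_const (1 : ℝ)).indicator hBm |>.const_mul Dn) hpt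
  -- the case analysis bounds `P(B)`
  have hsub := sameSide_ratio_gt_subset (κ := κ) hy hyx hδ₀ hz₀ hz₀' hδ₁ hδ₁y hyR₁ t
  have hPB : preWienerMeasure.real B ≤
      preWienerMeasure.real {ω | (t : WithTop ℝ≥0) < swallowingTime (sleDriving κ ω) y} +
        preWienerMeasure.real (sleRatioExceeds κ x y R) + preWienerMeasure.real (sleFlowExceeds κ y R₁) +
        preWienerMeasure.real (sleFlowsSmall κ x y ((1 + δ₀) / δ₀) δ₁) := by
    refine (measureReal_mono hsub).trans ?_
    refine (measureReal_union_le _ _).trans ?_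
    gcongr
    refine (measureReal_union_le _ _).trans ?_
    gcongr
    exact measureReal_union_le _ _
  have hDn0 : 0 ≤ Dn := by
    have h1 := hM (x / (x - y)) (hz1.trans hz₀)
    have h2 := hmono hz1 (hz1.trans hz₀) hz₀
    simp only [hDn]; linarith
  exact hI.trans (mul_le_mul_of_nonneg_left hPB hDn0)

end Levels

/-! ### The limiting argument -/

/-- **Two boundary points on the same side are swallowed at the same time with positive
probability, `4 < κ < 8`**: for `0 < y < x`, `P[T_y = T_x] > 0` — the weak form of
Rohde–Schramm's Lemma 6.6 ("for `a < b < 0` there is positive probability that the interval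
`[a, b]` is swallowed all at once", by reflection) used in the proof of Lemma 7.3.
[cite: RohdeSchramm2005, Lemma 6.6] -/
theorem measure_swallowingTime_eq_pos (hκ4 : 4 < κ) (hκ8 : κ < 8) (hy : 0 < y) (hyx : y < x) :
    0 < preWienerMeasure {ω | swallowingTime (sleDriving κ ω) y = swallowingTime (sleDriving κ ω) x} := by
  haveI := isProbabilityMeasure_preWienerMeasure'
  set μ : Measure (ℝ≥0 → ℝ) := preWienerMeasure with hμ
  have hx : 0 < x := hy.trans hyx
  have hxy : 0 < x - y := by linarith
  set a : ℝ := 2 / (κ : ℝ) with ha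
  have hκ4' : (4 : ℝ) < κ := by exact_mod_cast hκ4
  have hκ8' : (κ : ℝ) < 8 := by exact_mod_cast hκ8
  have ha4 : 1 / 4 < a := by rw [ha, div_lt_div_iff₀ (by norm_num) (by linarith)]; linarith
  set h := sameSideH a with hh
  set z₀ : ℝ := x / (x - y) with hz₀def
  have hz₀1 : 1 < z₀ := (one_lt_div hxy).2 (by linarith)
  set δ₀ : ℝ := (z₀ - 1) / 2 with hδ₀def
  have hδ₀ : 0 < δ₀ := by simp only [hδ₀def]; linarith
  have hz₀ : 1 + δ₀ < z₀ := by simp only [hδ₀def]; linarith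
  set M : ℝ := (2 : ℝ) ^ (2 * a) * ((2 : ℝ) ^ (1 - 4 * a) / (4 * a - 1)) with hMdef
  have hM : ∀ z : ℝ, 1 < z → h z ≤ M := fun z hz ↦ sameSideH_le ha4 hz
  have hmono : StrictMonoOn h (Ioi 1) := strictMonoOn_sameSideH a
  have hz1 : (1 : ℝ) < 1 + δ₀ := by linarith
  have hc₀ : 0 < h z₀ - h (1 + δ₀) := sub_pos.2 (hmono hz1 (hz1.trans hz₀) hz₀)
  set Dn : ℝ := M - h (1 + δ₀) with hDn
  have hDn : 0 < Dn := by have := hM z₀ hz₀1; simp only [hDn]; linarith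
  set c₁ : ℝ := (h z₀ - h (1 + δ₀)) / Dn with hc₁
  have hc₁pos : 0 < c₁ := div_pos hc₀ hDn
  set C : ℝ := (1 + δ₀) / δ₀ with hC
  have hCpos : 0 < C := by positivity
  -- the bad/good events
  set E : Set (ℝ≥0 → ℝ) := {ω | swallowingTime (sleDriving κ ω) y = swallowingTime (sleDriving κ ω) x} with hE
  set N : Set (ℝ≥0 → ℝ) := {ω | swallowingTime (sleDriving κ ω) y = ⊤} with hN
  have hN0 : μ N = 0 := by
    have hae := sle_swallowingTime_lt_top_of_onePointMartingales sle_martingale_onePointPow_holds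
      sle_martingale_onePointSq_holds hκ4 hy
    rw [ae_iff] at hae
    refine measure_mono_null (fun ω hω ↦ ?_) hae
    simp only [mem_setOf_eq] at hω ⊢
    rw [hω]; exact lt_irrefl _
  set p : ℝ := μ.real (E ∪ N) with hp
  have hpE : p ≤ μ.real E := by
    calc p ≤ μ.real E + μ.real N := measureReal_union_le _ _
      _ = μ.real E := by rw [show μ.real N = 0 by simp [measureReal_def, hN0], add_zero]
  -- STEP A: the levels bound, for `R` with `z₀ < 1 + R`, `δ₁ = y/(n+2)`, `R₁ = y + m + 1`, `t`
  have hA : ∀ R : ℝ, z₀ < 1 + R → ∀ (n m : ℕ) (t : ℝ≥0),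
      c₁ ≤ μ.real {ω | (t : WithTop ℝ≥0) < swallowingTime (sleDriving κ ω) y} +
        μ.real (sleRatioExceeds κ x y R) + μ.real (sleFlowExceeds κ y (y + m + 1)) +
        μ.real (sleFlowsSmall κ x y C (y / (n + 2))) := by
    intro R hR n m t
    have hδ₁ : 0 < y / (n + 2) := by positivity
    have hδ₁y : y / (n + 2) < y := by rw [div_lt_iff₀ (by positivity)]; nlinarith
    have hyR₁ : y < y + m + 1 := by linarith [m.cast_nonneg (α := ℝ)]
    have hb := sameSide_levels_bound (κ := κ) hy hyx hδ₀ hz₀ hR hδ₁ hδ₁y hyR₁ hκ4 hM t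
    rw [hc₁, div_le_iff₀ hDn]
    linarith
  -- STEP B1: `P[T_y > t] → 0`
  have hB1 : Tendsto (fun k : ℕ ↦ μ.real {ω | ((k : ℝ≥0) : WithTop ℝ≥0) < swallowingTime (sleDriving κ ω) y})
      atTop (𝓝 0) := by
    set S : ℕ → Set (ℝ≥0 → ℝ) := fun k ↦ {ω | ((k : ℝ≥0) : WithTop ℝ≥0) < swallowingTime (sleDriving κ ω) y}
      with hSdef
    have hSm : ∀ k, MeasurableSet (S k) := fun k ↦ by
      have : S k = {ω | 0 < sleRealFlowStop κ y k ω} := by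
        ext ω
        simp only [hSdef, mem_setOf_eq, sleRealFlowStop_apply]
        rw [realFlowStop_pos_iff (continuous_sleDriving κ ω) (by rw [sleDriving_zero]; exact hy)]
      rw [this]
      exact measurableSet_lt measurable_const ((adapted_sleRealFlowStop κ hy.ne' _).mono (brownianFiltration.le _) le_rfl)
    have hSanti : Antitone S := by
      intro k l hkl ω hω
      simp only [hSdef, mem_setOf_eq] at hω ⊢
      exact lt_of_le_of_lt (by exact_mod_cast hkl) hω
    have hinter : μ (⋂ k, S k) = 0 := by
      refine measure_mono_null (fun ω hω ↦ ?_) hN0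
      simp only [hSdef, mem_iInter, mem_setOf_eq] at hω ⊢
      by_contra hT
      obtain ⟨T, hT'⟩ := WithTop.ne_top_iff_exists.1 hT
      obtain ⟨k, hk⟩ := exists_nat_gt (T : ℝ)
      have := hω k
      rw [← hT', WithTop.coe_lt_coe] at this
      have : (k : ℝ) < T := by exact_mod_cast this
      linarith
    have ht := tendsto_measure_iInter_atTop (μ := μ) (fun k ↦ (hSm k).nullMeasurableSet) hSanti ⟨0, measure_ne_top _ _⟩
    rw [hinter] at ht
    have := (ENNReal.tendsto_toReal ENNReal.zero_ne_top).comp ht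
    rw [ENNReal.toReal_zero] at this
    refine this.congr fun k ↦ ?_
    simp only [Function.comp_apply, hSdef, measureReal_def]
  -- STEP B2: `P[Y exceeds R₁ - 1] → 0`
  have hB2 : Tendsto (fun m : ℕ ↦ μ.real (sleFlowExceeds κ y (y + m + 1))) atTop (𝓝 0) := by
    set S : ℕ → Set (ℝ≥0 → ℝ) := fun m ↦ sleFlowExceeds κ y (y + m + 1) with hSdef
    have hSm : ∀ m, MeasurableSet (S m) := fun m ↦ measurableSet_sleFlowExceeds hy _
    have hSanti : Antitone S := by
      refine antitone_nat_of_succ_le fun m ω hω ↦ ?_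
      simp only [hSdef] at hω ⊢
      obtain ⟨q, hq0, hq⟩ := hω
      refine ⟨q, hq0, ?_⟩
      push_cast at hq ⊢
      linarith
    have hinter : μ (⋂ m, S m) = 0 := by
      refine measure_mono_null (fun ω hω ↦ ?_) hN0
      simp only [hSdef, mem_iInter] at hω
      exact swallowingTime_eq_top_of_forall_sleFlowExceeds hy fun n ↦ by
        obtain ⟨m, hm⟩ := exists_nat_ge ((n : ℝ) - y)
        obtain ⟨q, hq0, hq⟩ := hω m
        exact ⟨q, hq0, by linarith⟩
    have ht := tendsto_measure_iInter_atTop (μ := μ) (fun m ↦ (hSm m).nullMeasurableSet) hSanti ⟨0, measure_ne_top _ _⟩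
    rw [hinter] at ht
    have := (ENNReal.tendsto_toReal ENNReal.zero_ne_top).comp ht
    rw [ENNReal.toReal_zero] at this
    refine this.congr fun m ↦ ?_
    simp only [Function.comp_apply, hSdef, measureReal_def]
  -- STEP B3: `limsup P[flows small at scale y/(n+2)] ≤ p`
  have hB3 : ∀ ε : ℝ, 0 < ε → ∃ n : ℕ, μ.real (sleFlowsSmall κ x y C (y / (n + 2))) < p + ε := by
    intro ε hε
    set S : ℕ → Set (ℝ≥0 → ℝ) := fun n ↦ ⋃ m, ⋃ (_ : n ≤ m), sleFlowsSmall κ x y C (y / (m + 2)) with hSdef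
    have hSm : ∀ n, MeasurableSet (S n) := fun n ↦ MeasurableSet.iUnion fun m ↦
      MeasurableSet.iUnion fun _ ↦ measurableSet_sleFlowsSmall hy hyx _ _
    have hSanti : Antitone S := fun n n' hnn' ω hω ↦ by
      simp only [hSdef, mem_iUnion] at hω ⊢
      obtain ⟨m, hm, hmem⟩ := hω
      exact ⟨m, hnn'.trans hm, hmem⟩
    have hinter : μ (⋂ n, S n) ≤ μ (E ∪ N) := by
      refine measure_mono fun ω hω ↦ ?_
      simp only [hSdef, mem_iInter, mem_iUnion] at hω
      by_cases hT : swallowingTime (sleDriving κ ω) y = ⊤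
      · exact Or.inr hT
      · refine Or.inl (swallowingTime_eq_of_frequently_sleFlowsSmall hy hyx (C := C) (d := fun n : ℕ ↦ y / (n + 2))
          ?_ ?_ hT)
        · have h1 : Tendsto (fun n : ℕ ↦ y * (1 / ((n : ℝ) + 2))) atTop (𝓝 (y * 0)) := by
            refine (tendsto_const_nhds.div_atTop ?_).const_mul y
            exact tendsto_atTop_add_const_right _ _ tendsto_natCast_atTop_atTop
          rw [mul_zero] at h1
          refine h1.congr fun n ↦ ?_
          ring
        · rw [frequently_atTop]
          intro n
          obtain ⟨m, hm, hmem⟩ := hω n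
          exact ⟨m, hm, hmem⟩
    have ht := tendsto_measure_iInter_atTop (μ := μ) (fun n ↦ (hSm n).nullMeasurableSet) hSanti ⟨0, measure_ne_top _ _⟩
    have htr := (ENNReal.tendsto_toReal (measure_ne_top _ _)).comp ht
    have hlim : (μ (⋂ n, S n)).toReal ≤ p := by
      rw [hp, measureReal_def]
      exact ENNReal.toReal_mono (measure_ne_top _ _) hinter
    have hev : ∀ᶠ n in atTop, (μ (S n)).toReal < p + ε :=
      htr.eventually (gt_mem_nhds (by linarith))
    obtain ⟨n, hn⟩ := hev.exists
    refine ⟨n, lt_of_le_of_lt ?_ hn⟩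
    rw [measureReal_def]
    refine ENNReal.toReal_mono (measure_ne_top _ _) (measure_mono fun ω hω ↦ ?_)
    simp only [hSdef, mem_iUnion]
    exact ⟨n, le_rfl, hω⟩
  -- STEP C: `P[ratio exceeds R] ≥ c₁ - p` for every `R` with `z₀ < 1 + R`
  have hC : ∀ R : ℝ, z₀ < 1 + R → c₁ - p ≤ μ.real (sleRatioExceeds κ x y R) := by
    intro R hR
    refine le_of_forall_pos_lt_add fun ε hε ↦ ?_
    have hε3 : 0 < ε / 3 := by positivity
    obtain ⟨k, hk⟩ := (hB1.eventually (gt_mem_nhds hε3)).exists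
    obtain ⟨m, hm⟩ := (hB2.eventually (gt_mem_nhds hε3)).exists
    obtain ⟨n, hn⟩ := hB3 (ε / 3) hε3
    have h := hA R hR n m k
    linarith
  -- STEP D: `R → ∞`
  have hD : c₁ - p ≤ p := by
    set S : ℕ → Set (ℝ≥0 → ℝ) := fun n ↦ sleRatioExceeds κ x y (z₀ + n) with hSdef
    have hSm : ∀ n, MeasurableSet (S n) := fun n ↦ measurableSet_sleRatioExceeds hy hyx _
    have hSanti : Antitone S := by
      intro n n' hnn' ω hω
      simp only [hSdef] at hω ⊢
      obtain ⟨q, hq0, hq⟩ := hω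
      refine ⟨q, hq0, lt_of_le_of_lt ?_ hq⟩
      have : (n : ℝ) ≤ n' := by exact_mod_cast hnn'
      linarith
    have hinter : μ (⋂ n, S n) ≤ μ (E ∪ N) := by
      refine measure_mono fun ω hω ↦ ?_
      simp only [hSdef, mem_iInter] at hω
      by_cases hT : swallowingTime (sleDriving κ ω) y = ⊤
      · exact Or.inr hT
      · refine Or.inl (swallowingTime_eq_of_forall_sleRatioExceeds hy hyx (fun n ↦ ?_) hT)
        obtain ⟨m, hm⟩ := exists_nat_ge ((n : ℝ) - z₀)
        obtain ⟨q, hq0, hq⟩ := hω m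
        exact ⟨q, hq0, by linarith⟩
    have ht := tendsto_measure_iInter_atTop (μ := μ) (fun n ↦ (hSm n).nullMeasurableSet) hSanti ⟨0, measure_ne_top _ _⟩
    have htr := (ENNReal.tendsto_toReal (measure_ne_top _ _)).comp ht
    have hlim : (μ (⋂ n, S n)).toReal ≤ p := by
      rw [hp, measureReal_def]
      exact ENNReal.toReal_mono (measure_ne_top _ _) hinter
    have hge : ∀ n, c₁ - p ≤ (μ (S n)).toReal := fun n ↦ by
      rw [← measureReal_def]
      exact hC (z₀ + n) (by linarith [n.cast_nonneg (α := ℝ)])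
    exact (ge_of_tendsto' htr hge).trans hlim
  -- conclusion
  have hp0 : 0 < p := by linarith
  have hEpos : 0 < μ.real E := hp0.trans_le hpE
  rw [measureReal_def] at hEpos
  exact ENNReal.toReal_pos_iff.1 hEpos |>.1

end Literature.Probability.RandomPlanarGeometry
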